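import Literature.MathematicalPhysics.QuantumFieldTheory.ConformalBootstrap3D.PointKernelK34v2Data
import Literature.MathematicalPhysics.QuantumFieldTheory.ConformalBootstrap3D.PointKernelParts

/-!
# K34v2 certificate, kernel part file P4: one-cell head segments 97 in level ranges

The head cells whose kernel evaluation exceeds one `decide` are one-cell segments of `hsegsK34v2`; each is
checked by `PCert.hPartSideOK` (side conditions) and `PCert.hPartOK` per level range `[n_lo, n_lo + count)`
against an integer claim, the claims summing to `≥ 0` (`PointKernel.partsOK`); soundness is
`PCert.hParts_sound` (`PointKernelParts`).  The part files `P1, P2, …` are mutually independent (each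
imports only the data file); the ranges of one cell may span several of them, and the per-cell
conclusions `hparts_i` / `hcell_i` of those cells are assembled in `PointKernelK34v2.lean`.
Estimated kernel time 253 s.
-/

set_option maxRecDepth 100000
set_option maxHeartbeats 0

namespace Literature.MathematicalPhysics.QuantumFieldTheory.ConformalBootstrap3D.PointKernelK34v2

open Literature.MathematicalPhysics.QuantumFieldTheory.ConformalBootstrap3D.PointKernel

/-- levels `[41, 49)` of segment 97: partial lower sum `≥` claim. [folklore] -/
theorem part_97_2 : certK34v2.hPartOK (PCert.segAt hsegsK34v2 97) JHK34v2 41 8 (632518018535497450824682374468710935) = true := by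
  decide +kernel

/-- levels `[49, 56)` of segment 97: partial lower sum `≥` claim. [folklore] -/
theorem part_97_3 : certK34v2.hPartOK (PCert.segAt hsegsK34v2 97) JHK34v2 49 7 (229032497240093028576835302581715216) = true := by
  decide +kernel

/-- levels `[56, 61)` of segment 97: partial lower sum `≥` claim. [folklore] -/
theorem part_97_4 : certK34v2.hPartOK (PCert.segAt hsegsK34v2 97) JHK34v2 56 5 (74745342856770075625694615992578407) = true := by
  decide +kernel

/-- levels `[61, 66)` of segment 97: partial lower sum `≥` claim. [folklore] -/
theorem part_97_5 : certK34v2.hPartOK (PCert.segAt hsegsK34v2 97) JHK34v2 61 5 (37798568907133324895281776458608240) = true := by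
  decide +kernel

/-- levels `[66, 67)` of segment 97: partial lower sum `≥` claim. [folklore] -/
theorem part_97_6 : certK34v2.hPartOK (PCert.segAt hsegsK34v2 97) JHK34v2 66 1 (-2540256117443688086980226463158922) = true := by
  decide +kernel

end Literature.MathematicalPhysics.QuantumFieldTheory.ConformalBootstrap3D.PointKernelK34v2
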